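import Literature.MathematicalPhysics.QuantumFieldTheory.Balaban1983to89.B8Eq119TwistedAxial
import Literature.MathematicalPhysics.QuantumFieldTheory.Balaban1983to89.B7Eq214General

/-!
# `Balaban1983to89.B8Eq178Averages` — T. Bałaban, *Spaces of regular gauge field configurations on a lattice and
# gauge fixing conditions*, Commun. Math. Phys. **99** (1985) 75–102 [Balaban1985RegularSpaces], p. 90: the averages
# `ũ′ʲ = (R̄₀u′u₁)ʲ((R̄₀u₁)ʲ)⁻¹` of (1.78), «(1.68) ⇒ (1.29) for `u₁`», «(1.29) for `u′u₁` ⇔ (1.78) ⇔ (1.79)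
# `Q′(u₁, λ) = 0` on `𝔅_k`», PROVED on the `ℤᵈ` carriers, together with the kernel identity of the two tree encodings of
# the averaging operation `R̄₀uʲ` of [3] (78)–(80)

statement-level skeleton of published theorems with citation tags; proofs where landed; nothing here is a claim about the Yang–Mills mass gap

PDF held: `paper:balaban1985-cmp99-regular-spaces-gauge-fixing` (journal page = PDF page + 74); pages read for this
module AS IMAGES: renders `run/shared/lean/pub/pub-balaban/b2b-balaban-ref1/pages/1985-cmp99-regular-spaces-gauge-fixing/
…-p014-x2.png` (p. 88, (1.68)–(1.69)) and `…-p016-x2.png` (p. 90, (1.77)–(1.85)); [3] = T. Bałaban, *Averaging operations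
for lattice gauge theories*, Commun. Math. Phys. **98** (1985) 17–51 [Balaban1985Averaging], (78)–(80) p. 30, (178)–(179)
p. 45, (207)–(208) p. 50 (held: `paper:balaban1985-cmp98-averaging`, journal page = PDF page + 16; text pages p0014, p0029,
p0034 and the quotations in the tree modules `B7Eq78Linearization`, `B7Prop9Flat`, `B7Prop10General`, `B7Eq214General`).

CITATION HEADER (lean-in-tree rule).  Cell `lit-balaban` (HOME `run/shared/lean/pub/lit-balaban/`), unit `lit-balaban-r05`
gen 5 (reader/typer and fold owner of block B8), an ANNOUNCED build (HOME/STATUS.md `TAKING B8.Eq1.79 → B8Eq178Averages.lean`,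
2026-08-21).  WHAT IS REPRODUCED = SKELETON row `B8.Eq1.79` ((1.78)–(1.79) p. 90; typed-existing hitherto only as the
ABSTRACT field `B8.LandauData.Solves`) and the sentence of p. 90 preceding it ((1.68) ⇒ (1.29), companion of rows
`B8.Eq1.69` and `B8.Eq1.29`), on the CONCRETE `ℤᵈ` carriers of the lineage: the typed (1.29) `B8Eq119TwistedAxial.Restr129`
(b2b cell) and the averages `B7Eq84Concrete.uavg` / `B7Prop10General.utilG` (unit `lit-balaban-r04`).  Kind «definition +
kernel-checked proof»; no `… : Prop` fact without a body is introduced; nothing of the abstract carrier `B8.lean` is modified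
or instantiated.

WHAT IS PRINTED (verbatim).
* B8 p. 81 [PDF 7], (1.29): *"`(\overline{R₀u}{}^j)(y) = 1` for `y ∈ Λ_j`, `j = 0, 1, …, k`."* (typed: `B8Eq119TwistedAxial.Restr129`).
* B8 p. 88 [PDF 14], (1.68): *"Applying the inductive hypothesis we get a gauge transformation `u₁` such that
  `(\overline{R₀u₁})ʲ(y) = 1` for `y ∈ Λ_j`, `j = 0, 1, …, k − 2`, and for `y ∈ Λ_{k−1} ∪ B(Λ_k)`, `j = k − 1`, (1.68)"*.
* B8 p. 90 [PDF 16]: *"The configuration `u₁` is fixed and determined by `U₁`, hence we keep the same meaning of `α₃` as before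
  (i.e. `α₃ = 16dB₁(α₀ + α₁)`). The transformation `u′u₁` has to satisfy the conditions (1.29), and `u₁` satisfies (1.68). Of
  course `(\overline{R₀u₁}{}^{k−1})(x) = 1` for `x ∈ B(Λ_k)` implies `(\overline{R₀u₁}{}^k)(y) = 1` for `y ∈ Λ_k`, hence `u₁`
  satisfies the conditions (1.29) and we may write these conditions for `u′u₁` in the following way
  `ũ′ʲ = \overline{R₀u′u₁}{}^j(\overline{R₀u₁}{}^j)⁻¹ = 1` on `Λ_j`, `j = 0, 1, …, k`, (1.78) or equivalently as
  `Q′(u₁, λ) = 0` on `𝔅_k`, `λ = (1/i) log u′`, (1.79) where `Q′(u₁, λ, y) = Q′_j(u₁, λ, y)` for `y ∈ Λ_j ⊂ 𝔅_k`."*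
* [3] p. 30 [PDF 14], (78)–(80): *"`(R̄₀v)(y) = (R(V₀)v‾)(y) = {(R(V₀)v)(x)}‾_{x∈B(y)} = v(y) exp[i Σ_{x∈B(y)} L⁻ᵈ (1/i) log
  v⁻¹(y)R(V₀(Γ_{y,x}))v(x)]`, (78) … `(R̄₀u)(x₁) = (R(U₀)u‾)(x₁)`, `x₁ ∈ Ω⁽¹⁾`, (79)
  `(R̄₀u^{j+1})(x_{j+1}) = (R(Ū₀ʲ)R̄₀uʲ‾)(x_{j+1})`, `x_{j+1} ∈ Ω⁽ʲ⁺¹⁾`. (80)"*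
* [3] p. 45 [PDF 29], (178)–(179): *"We will consider the averages `ũ′ʲ = \overline{R₀u′u₁}ʲ(\overline{R₀u₁}ʲ)⁻¹`. (178) As in the
  case of averages `Ũ′ʲ`, it can be easily seen that they may be defined inductively as `ũ′¹ = ũ′ = \overline{R₀u′u₁}(\overline{R₀u₁})⁻¹`,
  `ũ′^{j+1} = \overline{R̄₀ʲũ′ʲ\overline{R₀u₁}ʲ}(\overline{R̄₀ʲ\overline{R₀u₁}ʲ})⁻¹`. (179)"*
* [3] p. 50 [PDF 34], (208): *"It is obvious from the definition of the averaging operations that `ũ′ʲ` are analytic functions of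
  `λ`, and `Q′_j(u₁, λ) = (1/i) log ũ′ʲ`, `j ≦ k`, (208) are analytic functions of `λ` also."*; Proposition 10 p. 50 and
  (203)–(204) p. 49 (`|ũ′ʲ(y) − 1| < …`, typed `B7Prop10General.prop10_general_of52`).

WHAT THIS FILE PROVES (kernel, no `sorry`, standard axioms).  Carriers: `𝔸` a complete normed `ℂ`-algebra (the matrix algebra
of print), gauge functions `u : ℤᵈ → 𝔸ˣ`, backgrounds `U₀ : ℤᵈ → Fin d → 𝔸ˣ`, every level `ℤᵈ` in scaled coordinates (blocks
`B(y) = QuantumLattice.blockSites L y = {Ly + t : t ∈ [0,L)ᵈ}`), level sets `Λ : ℕ → Set ℤᵈ` (`Λ j` in level-`j` coordinates,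
as in `Restr129`), `log` = the series (21) of [3] `MatrixLog.mlog`.
§1 **THE TWO TREE ENCODINGS OF `R̄₀uʲ` AGREE** (`rbar_bgT_eq_uavg`): the averaging (79)–(80) of [3] as typed for B8's (1.29)
   — `B7Eq78Linearization.Rbar (zdBlocking d L) (B8Eq119TwistedAxial.bgT L U₀)` (abstract block carrier `Blocking`, transporters
   `Ū₀ʲ(Γ_{Ly,x}) = bgT L U₀ j y x`, `𝔸`-valued functions; cell `b2b-balaban`) — and as typed for [3]'s Sects. C/F —
   `B7Eq84Concrete.uavg L U₀ u j` (iterated twisted site average `B7Eq99Concrete.R0avg`, unit-valued; the object of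
   `B7Prop10General`, `B7Eq214General`, `B9Eq3114Proof`) — are EQUAL for every `L, U₀, u, j` (one step `avgStep_bgT_eq_R0avg` = the
   reindexing `blockSites L y ↔ Ly + boxVec L r` of the same display (78); cf. the one-block identity `B9Eq3114Proof.val_R0avg_eq_avgStep`
   of p05).  Consequence `restr129_iff_uavg`: the typed (1.29) reads `∀ j ≤ k, ∀ y ∈ Λ_j, uavg L U₀ u j y = 1`.
§2 **(178) = (179) AT A GENERAL BACKGROUND** (`utilG_eq_uavg_mul_inv`): r04's inductively defined `ũ′ʲ = B7Prop10General.utilG`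
   ((179)) IS the closed form (178) `(\overline{R₀u′u₁})ʲ·((\overline{R₀u₁})ʲ)⁻¹` for every background ([3] p. 45 "it can be easily
   seen"; the flat case `U₀ = 1` is `B7Prop9Flat.util`/`util_succ`), by induction on `j` with (80).
§3 **p. 90, «(R̄₀u₁)^{k−1} = 1 on B(Λ_k) ⇒ (R̄₀u₁)ᵏ = 1 on Λ_k», hence (1.68) ⇒ (1.29)**: `avgStep_eq_one` (one (78)-step of a
   function equal to `1` on the block is `1`: every logarithm is `log 1 = 0`), `rbar_succ_eq_one_of_block` (the displayed
   implication, any level `j` in place of `k − 1`), `Cond168` = (1.68) typed on the same carriers as `Restr129` (with print's `k`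
   written `k + 1`: levels `j < k`, level `k` on `Λ_k ∪ B(Λ_{k+1})`), **`restr129_of_cond168`** = "hence `u₁` satisfies the
   conditions (1.29)" (for `L ≥ 1`, so that a block contains its base point).
§4 **(1.78) and «(1.29) for `u′u₁` ⇔ (1.78)»**: `util178 L U₀ u′ u₁ j y` := the printed `ũ′ʲ(y) = (\overline{R₀u′u₁})ʲ(y)·((\overline{R₀u₁})ʲ(y))⁻¹`
   built from the `Restr129` averages (`Ring.inverse` for the inverse in `𝔸`), `util178_eq_utilG` (= r04's `utilG`, by §§1–2),
   `Cond178` = (1.78) «`ũ′ʲ = 1` on `Λ_j`, `j = 0, …, k`», **`restr129_mul_iff_cond178`**: if `u₁` satisfies (1.29) then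
   «`u′u₁` satisfies (1.29)» ⇔ (1.78) — the sentence "we may write these conditions for `u′u₁` in the following way (1.78)".
§5 **(1.79) ⇔ (1.78)**: `Qnl L U₀ u′ u₁ j y := log ũ′ʲ(y)` = `Q′_j(u₁, λ)(y)` of (208) in the convention of `B7Eq214General`
   (print's factor `1/i` absorbed into the Lie-algebra variable: `λ := log u′`; the zero set is unchanged), `Cond179` = (1.79)
   «`Q′(u₁, λ) = 0` on `𝔅_k`» with `Q′(u₁, λ, y) = Q′_j(u₁, λ, y)` for `y ∈ Λ_j`; `cond179_of_cond178` (`log 1 = 0`),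
   `cond178_of_cond179` / **`cond178_iff_cond179`** under the domain condition `‖ũ′ʲ(y) − 1‖ < 1` on `𝔅_k` ("or equivalently":
   `log` is injective on the ball where the series (21) inverts `exp`, `MatrixLog.exp_mlog`), and **`cond178_iff_cond179_of52`**:
   the domain condition DISCHARGED by [3] Proposition 10 at a general background (`B7Prop10General.prop10_general_of52`, (204):
   `‖ũ′ʲ − 1‖ ≤ C₆α₄ ≤ 1/10`) from (52), (176), (177), (166)–(167) and its explicit smallness; `restr129_mul_iff_cond179` = the
   full sentence «(1.29) for `u′u₁` ⇔ (1.79)» given (1.29) for `u₁` and the domain condition.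
HONEST SCOPE / READINGS (recorded; none is an objection to print).  (a) Carriers = the lineage's: all of `ℤᵈ` per level in scaled
coordinates, the sets `Ω_j`, `Λ_j`, `𝔅_k` entering only through `Λ : ℕ → Set ℤᵈ` (as in `Restr129`); `𝔸`-valued gauge functions
(unitarity not needed for these identities).  (b) (1.79)'s `λ = (1/i) log u′`: the file works with `u′` itself (and r04's
`λ := log u′`); the map `λ ↦ u′ = e^{iλ}` and B8's (1.77) are not used — (1.78) ⇔ (1.79) needs only `‖ũ′ʲ − 1‖ < 1`, which print's
standing assumptions give through [3] Prop. 10; the discharge `cond178_iff_cond179_of52` is stated under [3]'s one-level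
hypotheses (176)/(177) with `η = L^{−k}` exactly as `prop10_general_of52` takes them, NOT under B8's level-dependent (1.77) on the
domain sequence `{Ω_j}` (p. 90: "(1.77) … imply the regularity conditions (176), (177) on `Ω_j ⊂ T_{L^{−j}}` with `4α₄`" — that
multi-region refinement is not typed here).  (c) Nothing is asserted about existence/uniqueness of `u′` (Proposition 5, rows
B8.Prop5/B8.Eq1.111) or about the linear part of `Q′_j(u₁, λ)` ((213)–(214): `B7Eq214General.eq214_general_of207`, whose
`log ũ′ʲ` is this file's `Qnl` by `Qnl_eq_mlog_utilG`).
§6 (v1.1) **THE TWO TREE ENCODINGS OF `Q′_j(U₀)` AGREE** (`qprimeIter_bgT_eq_lamAvgG`): B8/B9's `Q′_j` =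
   `B7Eq78Linearization.QprimeIter (zdBlocking d L) (bgT L U₀)` ((3.19) of [4]; the object of `B9Eq3114Proof`, of the N(Q′(U₀)) of
   (1.27)–(1.29) and of the PROVED "linear part of R̄₀uʲ" `hasDerivAt_invI_smul_mlog_Rbar_zd`) EQUALS r04's `B7Eq214General.lamAvgG L U₀`
   ((212)–(213), recursion (77)/(80)) for every `j` — the same reindexing as §1; hence **`eq214_qprimeIter_of207`** = [3] (213)–(214)
   AT A GENERAL BACKGROUND IN B8's VOCABULARY: `‖Q′_j(u₁, λ)(z) − (Q′_jλ)(z)‖ ≤ 16C′_gen(α₃α₄ + α₄²)Lʲη` for `Q′_j(u₁, λ) = Qnl` ((208))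
   and `Q′_j = QprimeIter (zdBlocking d L) (bgT L U₀)`, `u′ = e^{λ}`, under (52), (207), (166)–(167) and r04's explicit smallness
   (`B7Eq214General.eq214_general_of207` transported along `Qnl_eq_mlog_utilG` and §6) — the input «(213) of [3]: Q′(u₁, λ) = Q′λ +
   C′(λ)» of rows B8.Eq1.113 ((1.115)) / B8.Eq1.121 ((1.121) "by the inequality (214)") on concrete carriers, with [3]'s ONE-LEVEL
   hypothesis (207) (B8's region-dependent (1.119)–(1.120) on `{Ω_j}` is the multi-region refinement, not typed here, cf. (b)).
§7 (v1.2) **(1.77) and «(1.77) ⇒ (176), (177) on `Ω_j ⊂ T_{L^{−j}}` with `4α₄`»** (p. 90: "These conditions imply the regularity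
   conditions (176), (177) on `Ω_j ⊂ T_{L^{−j}}`, with `4α₄` instead of `α₄`"; row B8.Eq1.77, hitherto abstract `B8.LandauData.lamNorm`):
   `Cond177` = (1.77) pointwise on the `ℤᵈ` carriers (`|λ(x)| < α₄`; `|(D^η_{U₀}λ)(b)| < α₄(Lʲη)⁻¹` for `b ∈ Ω_j`, `j < k`, with
   `B8Ineq132.covDerivFwd`/`BondTouches`), **`reg176_of_cond177`** (`‖u′(x) − 1‖ < 4α₄`, `u′ = e^{λ}`) and **`reg177_of_cond177`**
   (`‖u′(b₋)⁻¹R(U₀(b))u′(b₊) − 1‖ < 4α₄L^{−j}` for `b ∈ Ω_j` — (177) with `4α₄` at the lattice spacing `L^{−j}` of `T_{L^{−j}}`), for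
   `α₄ ≤ ¼`, by r04's certificates `B7Eq214.ineq176_of_207` / `ineq177_of_207`.
§8 (v1.3) **(1.75)–(1.76) p. 89** (row B8.Eq1.77's first displays: the regularity class of `u′`): `ineq175` — the displayed
   triangle inequality `|u′⁻¹(b₋)R_{0,b}u′(b₊) − 1| ≦ |u′⁻¹(b₋)U_{1,b}R_{0,b}u′(b₊) − 1| + |u′⁻¹(b₋)(U_{1,b} − 1)R_{0,b}u′(b₊)|` with the
   second term `≤ |U_{1,b} − 1|` (`u′`, `U₀` `U1`-valued), `ineq175_lt` (`< a + a′` from the (1.62)- and (1.69)-type inputs; print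
   `2B₁(α₀ + α₁)η(Lʲη)⁻¹`), `ineq176_of_mul` — (1.76) `|u′ − 1| < 2c` from `|u′u₁ − 1| < c`, `|u₁ − 1| < c` (print `c = 16dB₁(α₀ + α₁)`).
§9 (v1.4) **(1.69) TYPED** (`Cond169`: «|A| < B₁(α₀+α₁)(Lʲη)⁻¹, |∇^η_{U₀}A| < B₁(α₀+α₁)(Lʲη)⁻² on Ω_j, j = 0, 1, …, k − 1», p. 88 —
   the owed member of the READING-RULE audit of row B8.Eq1.69, `lit-balaban-r05/READING-RULE-AUDIT-B8-g69.md` §3.9; companion of `Cond168`),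
   with `cond169_apply`, `cond169_mono`, `cond169_anti`.
DECLARATIONS: 7 definitions (`util178`, `Cond178`, `Qnl`, `Cond179`, `Cond168`, `Cond177`, `Cond169`), the rest theorems (2 private [folklore] helpers);
imports `B8Eq119TwistedAxial` (Restr129, bgT), `B7Eq214General` (→ `B7Prop10General`: utilG, prop10; lamAvgG, (214) @gen); REUSED BY NAME:
`B7Eq214General.lamAvgG, lamAvgG_succ, rlam_apply, Cgen, eq214_general_of207`, `B7Eq170Flat.cj_apply, bmean_apply`,
`B7Eq78Linearization.Qprime_apply, QprimeIter, QprimeIter_succ`, `B7Eq78Linearization.Rbar, Rbar_zero,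
Rbar_succ, avgStep, avgStep_eq_mul_exp_sum, conjR_apply, zdBlocking`, `B8Eq119TwistedAxial.Restr129, bgT, blockBase_eq_smul`,
`B7Eq84Concrete.uavg, uavg_zero, uavg_succ`, `B7Eq99Concrete.R0avg, val_R0avg`, `B7Prop9General.vtilG, CovBondBd`,
`B7Prop10General.utilG, utilG_zero, utilG_succ, prop10_general_of52, C6, C4G`, `B7Prop9Flat.SiteBd, C5'`, `B7Eq167Flat.InLambda`,
`B7Prop2Explicit.avgIter, AvgClosed, pdev, C0, c2'`, `B7Prop1Explicit.hol, treeWord, boxVec, axialFn, Site`, `B7Eq92Concrete.Rc_apply`,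
`MatrixLog.mlog, mlog_one, exp_mlog`, `QuantumLattice.blockSites, blockBase, mem_blockSites_iff, blockMap_blockBase`.
Unit `lit-balaban-r05` (gen 5), 2026-08-21.  v1.1 (APPEND-ONLY, same unit and generation): + §6 (`qprimeIter_bgT_eq_lamAvgG`,
`eq214_qprimeIter_of207`); import `B7Prop10General` ↦ `B7Eq214General` (which imports it); v1 declarations byte-identical.  v1.2
(APPEND-ONLY, same unit and generation): + §7 (`Cond177`, `reg176_of_cond177`, `reg177_of_cond177`; reuses `B7Eq214.ineq176_of_207`,
`ineq177_of_207`, `B8Ineq132.covDerivFwd`, `BondTouches`); v1.1 declarations byte-identical.  v1.3 (APPEND-ONLY, same unit and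
generation): + §8 (`ineq175`, `ineq175_lt`, `ineq176_of_mul`; reuses `B7Prop1Explicit.U1`, `mem_U1`, `norm_inv_sub_one_le`); v1.2 declarations
byte-identical.  v1.4 (APPEND-ONLY, unit `lit-balaban-r05` gen 69, 2026-08-23): + §9 (`Cond169`, `cond169_apply`, `cond169_mono`, `cond169_anti`);
v1.3 declarations byte-identical.

[cite: Balaban1985RegularSpaces, (1.77)–(1.79) p.90, (1.75)–(1.76) p.89, (1.68)–(1.69) p.88, (1.29) p.81; Balaban1985Averaging, (78)–(80) p.30,
(176)–(177) p.45, (178)–(179) p.45, (207)–(208) p.50, (212)–(214) p.50, Proposition 10 p.50]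
-/

noncomputable section

open NormedSpace Finset

namespace Literature.MathematicalPhysics.QuantumFieldTheory.Balaban1983to89.B8Eq178Averages

open B7Prop1Explicit B7Prop2Explicit MatrixLog B7Eq92Concrete B7Eq99Concrete B7Eq84Concrete B7Eq167Flat B7Prop9Flat
  B7Prop9General B7Prop10General
open B7Eq78Linearization (conjR conjR_apply Rbar Rbar_zero Rbar_succ avgStep avgStep_eq_mul_exp_sum zdBlocking Qprime Qprime_apply
  QprimeIter QprimeIter_succ)
open B7Eq214General (lamAvgG lamAvgG_succ rlam_apply Cgen eq214_general_of207)
open B7Eq170Flat (cj cj_apply bmean_apply)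
open B8Eq119TwistedAxial (bgT Restr129 blockBase_eq_smul)
open B8Ineq132 (covDerivFwd BondTouches)
open Literature.MathematicalPhysics.QuantumLattice (blockBase blockSites mem_blockSites_iff blockMap_blockBase)

-- `Site` alone would resolve to the torus sites of `Setup.lean`; re-export the `ℤ^d` sites of `B7Prop1Explicit`.
export B7Prop1Explicit (Site)

variable {d : ℕ}

variable {𝔸 : Type*} [NormedRing 𝔸] [NormedAlgebra ℂ 𝔸] [CompleteSpace 𝔸]

/-! ## §1 The two tree encodings of `R̄₀uʲ` ([3] (78)–(80)) agree -/

omit [NormedAlgebra ℂ 𝔸] [CompleteSpace 𝔸] in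
/-- A sum over the block `B(y) = {Ly + t : t ∈ [0,L)ᵈ}` (`QuantumLattice.blockSites`) is the sum over the corner offsets
`boxVec L r`, `r : Fin d → Fin L`, of the b07 lineage. [folklore] -/
private theorem sum_blockSites_smul {β : Type*} [AddCommMonoid β] (L : ℕ) (y : Site d) (F : Site d → β) :
    ∑ x ∈ blockSites L y, F x = ∑ r : Fin d → Fin L, F ((L : ℤ) • y + boxVec L r) := by
  classical
  rw [← blockBase_eq_smul]
  unfold blockSites
  rw [Finset.sum_image]
  · refine Finset.sum_bij' (fun t ht => fun k => ⟨t k, ?_⟩) (fun r _ => fun k => ((r k : ℕ)))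
      (fun _ _ => Finset.mem_univ _) (fun r _ => ?_) (fun _ _ => rfl) (fun _ _ => rfl) (fun _ _ => rfl)
    · exact Finset.mem_range.1 ((Fintype.mem_piFinset.1 ht) k)
    · exact Fintype.mem_piFinset.2 fun k => Finset.mem_range.2 (r k).isLt
  · intro t _ t' _ h
    funext i
    simpa using congr_fun h i

/-- **One step of (78)/(80) in the two encodings.**  The b2b typing of the twisted block average (78) — `avgStep` on the
block `blockSites L y` with weights `L⁻ᵈ` and the background transporters `bgT L U₀ j y x = Ū₀ʲ(Γ_{Ly,x})` — evaluated on a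
unit-valued function `v` IS the lineage's `R0avg L Ū₀ʲ v` at the corner `Ly` (`Ū₀ʲ = avgIter L U₀ j`): both are print's
`v(Ly) exp[Σ_{x∈B(Ly)} L⁻ᵈ log v(Ly)⁻¹R(Ū₀ʲ(Γ_{Ly,x}))v(x)]`. [cite: Balaban1985Averaging, (78) p.30, (80) p.30] -/
theorem avgStep_bgT_eq_R0avg (L : ℕ) (U₀ : Site d → Fin d → 𝔸ˣ) (j : ℕ) (v : Site d → 𝔸ˣ) (y : Site d) :
    avgStep (blockSites L y) (fun _ => ((L : ℝ) ^ d)⁻¹) (bgT L U₀ j y) ((v (blockBase L y) : 𝔸ˣ) : 𝔸)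
        (fun x => ((v x : 𝔸ˣ) : 𝔸))
      = ((R0avg L (avgIter L U₀ j) v ((L : ℤ) • y) : 𝔸ˣ) : 𝔸) := by
  rw [avgStep_eq_mul_exp_sum, val_R0avg, blockBase_eq_smul, sum_blockSites_smul]
  refine congrArg (fun s => ((v ((L : ℤ) • y) : 𝔸ˣ) : 𝔸) * exp s) (Finset.sum_congr rfl fun r _ => ?_)
  simp only [bgT, axialFn, blockBase_eq_smul, add_sub_cancel_left, Ring.inverse_unit, conjR_apply, Rc_apply,
    Units.val_mul]

/-- **THE TWO TREE ENCODINGS OF `R̄₀uʲ` AGREE** ((79)–(80) of [3] iterated): for every `L, U₀, u` and every level `j`,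
`Rbar (zdBlocking d L) (bgT L U₀) j u = (\overline{R₀u})ʲ = uavg L U₀ u j` — the object of B8's typed (1.29)
(`B8Eq119TwistedAxial.Restr129`) is the object of [3]'s Sects. C/F files (`B7Eq84Concrete.uavg`).
[cite: Balaban1985Averaging, (79)–(80) p.30; Balaban1985RegularSpaces, (1.29) p.81] -/
theorem rbar_bgT_eq_uavg (L : ℕ) (U₀ : Site d → Fin d → 𝔸ˣ) (u : Site d → 𝔸ˣ) :
    ∀ j : ℕ, Rbar (zdBlocking d L) (bgT L U₀) j (fun x => ((u x : 𝔸ˣ) : 𝔸)) = fun y => ((uavg L U₀ u j y : 𝔸ˣ) : 𝔸)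
  | 0 => by
    funext y
    rw [Rbar_zero, uavg_zero]
  | j + 1 => by
    funext y
    rw [Rbar_succ, rbar_bgT_eq_uavg L U₀ u j, uavg_succ]
    exact avgStep_bgT_eq_R0avg L U₀ j (uavg L U₀ u j) y

/-- (1.29) in the lineage's averages: `u` satisfies (1.29) iff `(\overline{R₀u})ʲ(y) = uavg L U₀ u j y = 1` for `y ∈ Λ_j`,
`j ≤ k`. [cite: Balaban1985RegularSpaces, (1.29) p.81; Balaban1985Averaging, (79)–(80) p.30] -/
theorem restr129_iff_uavg (L k : ℕ) (Λ : ℕ → Set (Site d)) (U₀ : Site d → Fin d → 𝔸ˣ) (u : Site d → 𝔸ˣ) :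
    Restr129 L k Λ U₀ u ↔ ∀ j, j ≤ k → ∀ y ∈ Λ j, uavg L U₀ u j y = 1 := by
  unfold Restr129
  simp only [rbar_bgT_eq_uavg, Units.val_eq_one]

/-! ## §2 (178) = (179) at a general background -/

/-- **(178) = (179) AT A GENERAL BACKGROUND** ([3] p. 45: "it can be easily seen that they may be defined inductively as
(179)"): r04's inductively defined `ũ′ʲ = utilG L U₀ u′ u₁ j` ((179), one step `vtilG` at `Ū₀ʲ`) is the closed form (178)
`(\overline{R₀u′u₁})ʲ((\overline{R₀u₁})ʲ)⁻¹`; by induction on `j` with (80) (`uavg_succ`).  Flat case: `B7Prop9Flat.util_succ`.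
[cite: Balaban1985Averaging, (178)–(179) p.45, (80) p.30] -/
theorem utilG_eq_uavg_mul_inv (L : ℕ) (U₀ : Site d → Fin d → 𝔸ˣ) (u' u₁ : Site d → 𝔸ˣ) :
    ∀ j : ℕ, utilG L U₀ u' u₁ j = fun z => uavg L U₀ (u' * u₁) j z * (uavg L U₀ u₁ j z)⁻¹
  | 0 => by
    funext z
    rw [utilG_zero, uavg_zero, uavg_zero, Pi.mul_apply, mul_inv_cancel_right]
  | j + 1 => by
    have hmul : utilG L U₀ u' u₁ j * uavg L U₀ u₁ j = uavg L U₀ (u' * u₁) j := by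
      funext z
      simp only [Pi.mul_apply, utilG_eq_uavg_mul_inv L U₀ u' u₁ j, inv_mul_cancel_right]
    funext z
    simp only [utilG_succ, vtilG, hmul, uavg_succ]

/-! ## §3 p. 90: «`(R̄₀u₁)^{k−1} = 1` on `B(Λ_k)` implies `(R̄₀u₁)ᵏ = 1` on `Λ_k`», hence (1.68) ⇒ (1.29) -/

omit [CompleteSpace 𝔸] in
/-- One (78)-step `(R̄₀v)(y) = v(y) exp[Σ_{x∈B(y)} L⁻ᵈ log v⁻¹(y)R(V₀(Γ_{y,x}))v(x)]` of a function `v` equal to `1` on the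
block and at the base point is `1`: every logarithm is `log(1⁻¹R(T_x)1) = log 1 = 0` (the fact behind p. 90 "Of course
`(\overline{R₀u₁}{}^{k−1})(x) = 1` for `x ∈ B(Λ_k)` implies `(\overline{R₀u₁}{}^k)(y) = 1`"; also `B7Eq78Linearization.avgStep_one`
for `v ≡ 1`). [cite: Balaban1985Averaging, (78) p.30; Balaban1985RegularSpaces, p.90 (sentence before (1.78))] -/
theorem avgStep_eq_one {ι : Type*} (t : Finset ι) (wt : ι → ℝ) (T : ι → 𝔸ˣ) {v : ι → 𝔸} (hv : ∀ x ∈ t, v x = 1) :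
    avgStep t wt T (1 : 𝔸) v = 1 := by
  rw [avgStep_eq_mul_exp_sum, one_mul, Finset.sum_eq_zero, exp_zero]
  intro x hx
  rw [hv x hx, Ring.inverse_one, one_mul, conjR_apply, mul_one, Units.mul_inv, mlog_one, smul_zero]

omit [NormedAlgebra ℂ 𝔸] [CompleteSpace 𝔸] in
/-- For `L ≥ 1` the block `B(y)` contains its base point `Ly`. [folklore] -/
private theorem blockBase_mem_blockSites {L : ℕ} (hL : 1 ≤ L) (y : Site d) : blockBase L y ∈ blockSites L y := by
  haveI : NeZero L := ⟨by omega⟩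
  exact (mem_blockSites_iff L y (blockBase L y)).2 (blockMap_blockBase L y)

/-- **p. 90, verbatim shape: "`(\overline{R₀u₁}{}^{k−1})(x) = 1` for `x ∈ B(Λ_k)` implies `(\overline{R₀u₁}{}^k)(y) = 1` for
`y ∈ Λ_k`"** — one level at a time: if the level-`j` average is `1` on the block `B(y)` below the level-`(j+1)` site `y`, the
level-`(j+1)` average (80) at `y` is `1` (for `L ≥ 1`, so that `B(y) ∋ Ly`), for the averages of the typed (1.29).
[cite: Balaban1985RegularSpaces, p.90 (sentence before (1.78)); Balaban1985Averaging, (80) p.30] -/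
theorem rbar_succ_eq_one_of_block {L : ℕ} (hL : 1 ≤ L) (U₀ : Site d → Fin d → 𝔸ˣ) (u : Site d → 𝔸) (j : ℕ) (y : Site d)
    (h : ∀ x ∈ blockSites L y, Rbar (zdBlocking d L) (bgT L U₀) j u x = 1) :
    Rbar (zdBlocking d L) (bgT L U₀) (j + 1) u y = 1 := by
  rw [Rbar_succ]
  show avgStep (blockSites L y) (fun _ => ((L : ℝ) ^ d)⁻¹) (bgT L U₀ j y)
      (Rbar (zdBlocking d L) (bgT L U₀) j u (blockBase L y)) (Rbar (zdBlocking d L) (bgT L U₀) j u) = 1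
  rw [h _ (blockBase_mem_blockSites hL y)]
  exact avgStep_eq_one _ _ _ h

/-- **(1.68) TYPED** on the carriers of `Restr129` (print's `k` written `k + 1`, so that no subtraction occurs): the inductive
gauge transformation `u₁` has `(\overline{R₀u₁})ʲ(y) = 1` for `y ∈ Λ_j`, `j = 0, …, k − 1` (print: `j ≤ k − 2`), and at level
`k` (print: `j = k − 1`) for `y ∈ Λ_k ∪ B(Λ_{k+1})` (print: `Λ_{k−1} ∪ B(Λ_k)`), `B(Λ_{k+1})` = the level-`k` blocks `B(y)`,
`y ∈ Λ_{k+1}`.  Abstract twin: the `u₁`-clause of `B8.LandauData.Hyp169`. [cite: Balaban1985RegularSpaces, (1.68) p.88] -/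
def Cond168 (L k : ℕ) (Λ : ℕ → Set (Site d)) (U₀ : Site d → Fin d → 𝔸ˣ) (u₁ : Site d → 𝔸ˣ) : Prop :=
  (∀ j, j < k → ∀ y ∈ Λ j, Rbar (zdBlocking d L) (bgT L U₀) j (fun x => ((u₁ x : 𝔸ˣ) : 𝔸)) y = 1) ∧
    (∀ y ∈ Λ k, Rbar (zdBlocking d L) (bgT L U₀) k (fun x => ((u₁ x : 𝔸ˣ) : 𝔸)) y = 1) ∧
    (∀ y ∈ Λ (k + 1), ∀ x ∈ blockSites L y, Rbar (zdBlocking d L) (bgT L U₀) k (fun x => ((u₁ x : 𝔸ˣ) : 𝔸)) x = 1)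

/-- **p. 90: "hence `u₁` satisfies the conditions (1.29)"** — (1.68) implies (1.29) (with `k + 1` levels, print's `k`), for
`L ≥ 1`. [cite: Balaban1985RegularSpaces, p.90 (sentence before (1.78)), (1.68) p.88, (1.29) p.81] -/
theorem restr129_of_cond168 {L : ℕ} (hL : 1 ≤ L) {k : ℕ} {Λ : ℕ → Set (Site d)} {U₀ : Site d → Fin d → 𝔸ˣ}
    {u₁ : Site d → 𝔸ˣ} (h : Cond168 L k Λ U₀ u₁) : Restr129 L (k + 1) Λ U₀ u₁ := by
  obtain ⟨hlt, hk, hblk⟩ := h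
  intro j hj y hy
  rcases Nat.lt_or_ge j k with hjk | hjk
  · exact hlt j hjk y hy
  · rcases Nat.eq_or_lt_of_le hjk with rfl | hkj
    · exact hk y hy
    · obtain rfl : j = k + 1 := le_antisymm hj hkj
      exact rbar_succ_eq_one_of_block hL U₀ _ k y (hblk y hy)

/-! ## §4 (1.78), and «(1.29) for `u′u₁` ⇔ (1.78)» -/

/-- **The averages `ũ′ʲ` of (1.78) / [3] (178)**: `ũ′ʲ(y) = (\overline{R₀u′u₁})ʲ(y)·((\overline{R₀u₁})ʲ(y))⁻¹`, built from the SAME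
averaging operation as the typed (1.29) (`Rbar (zdBlocking d L) (bgT L U₀)` of `Restr129`; the inverse in `𝔸` is `Ring.inverse`,
the inverse on units).  `= B7Prop10General.utilG` (`util178_eq_utilG`). [cite: Balaban1985RegularSpaces, (1.78) p.90;
Balaban1985Averaging, (178) p.45] -/
def util178 (L : ℕ) (U₀ : Site d → Fin d → 𝔸ˣ) (u' u₁ : Site d → 𝔸ˣ) (j : ℕ) (y : Site d) : 𝔸 :=
  Rbar (zdBlocking d L) (bgT L U₀) j (fun x => (((u' * u₁) x : 𝔸ˣ) : 𝔸)) y *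
    Ring.inverse (Rbar (zdBlocking d L) (bgT L U₀) j (fun x => ((u₁ x : 𝔸ˣ) : 𝔸)) y)

/-- `ũ′ʲ` of (1.78) IS r04's `utilG` ((179) at the background `U₀`), by §1 and §2.
[cite: Balaban1985RegularSpaces, (1.78) p.90; Balaban1985Averaging, (178)–(179) p.45] -/
theorem util178_eq_utilG (L : ℕ) (U₀ : Site d → Fin d → 𝔸ˣ) (u' u₁ : Site d → 𝔸ˣ) (j : ℕ) (y : Site d) :
    util178 L U₀ u' u₁ j y = ((utilG L U₀ u' u₁ j y : 𝔸ˣ) : 𝔸) := by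
  rw [util178, rbar_bgT_eq_uavg L U₀ (u' * u₁) j, rbar_bgT_eq_uavg L U₀ u₁ j, utilG_eq_uavg_mul_inv L U₀ u' u₁ j]
  simp only [Ring.inverse_unit, Units.val_mul]

/-- **(1.78) TYPED**: "`ũ′ʲ = \overline{R₀u′u₁}{}^j(\overline{R₀u₁}{}^j)⁻¹ = 1` on `Λ_j`, `j = 0, 1, …, k`".
[cite: Balaban1985RegularSpaces, (1.78) p.90] -/
def Cond178 (L k : ℕ) (Λ : ℕ → Set (Site d)) (U₀ : Site d → Fin d → 𝔸ˣ) (u' u₁ : Site d → 𝔸ˣ) : Prop :=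
  ∀ j, j ≤ k → ∀ y ∈ Λ j, util178 L U₀ u' u₁ j y = 1

/-- (1.78) in r04's objects: `∀ j ≤ k, ∀ y ∈ Λ_j, utilG L U₀ u′ u₁ j y = 1`. [cite: Balaban1985RegularSpaces, (1.78) p.90;
Balaban1985Averaging, (179) p.45] -/
theorem cond178_iff_utilG (L k : ℕ) (Λ : ℕ → Set (Site d)) (U₀ : Site d → Fin d → 𝔸ˣ) (u' u₁ : Site d → 𝔸ˣ) :
    Cond178 L k Λ U₀ u' u₁ ↔ ∀ j, j ≤ k → ∀ y ∈ Λ j, utilG L U₀ u' u₁ j y = 1 := by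
  unfold Cond178
  simp only [util178_eq_utilG, Units.val_eq_one]

/-- **p. 90: "`u₁` satisfies the conditions (1.29) and we may write these conditions for `u′u₁` in the following way (1.78)"**
— if `u₁` satisfies (1.29), then `u′u₁` satisfies (1.29) iff (1.78) holds (on `Λ_j` the denominator `(\overline{R₀u₁})ʲ(y)` of
`ũ′ʲ(y)` is `1`). [cite: Balaban1985RegularSpaces, (1.78) p.90, (1.29) p.81] -/
theorem restr129_mul_iff_cond178 {L k : ℕ} {Λ : ℕ → Set (Site d)} {U₀ : Site d → Fin d → 𝔸ˣ} {u₁ : Site d → 𝔸ˣ}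
    (h₁ : Restr129 L k Λ U₀ u₁) (u' : Site d → 𝔸ˣ) :
    Restr129 L k Λ U₀ (u' * u₁) ↔ Cond178 L k Λ U₀ u' u₁ := by
  unfold Restr129 Cond178
  refine forall₂_congr fun j hj => forall₂_congr fun y hy => ?_
  rw [util178, h₁ j hj y hy, Ring.inverse_one, mul_one]

/-! ## §5 (1.79) ⇔ (1.78) -/

/-- **(208) / (1.79): `Q′_j(u₁, λ)(y) := log ũ′ʲ(y)`** in the convention of `B7Eq214General` (print: `(1/i) log ũ′ʲ` with
`λ = (1/i) log u′`; the lineage absorbs the factor `1/i` into the Lie-algebra variable, `λ := log u′` — the zero set of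
`Q′_j(u₁, ·)` is unchanged), `log` = the series (21) `MatrixLog.mlog`; B8's `Q′(u₁, λ, y) = Q′_j(u₁, λ, y)` for `y ∈ Λ_j ⊂ 𝔅_k` is
this function read levelwise (`Cond179`). [cite: Balaban1985RegularSpaces, (1.79) p.90; Balaban1985Averaging, (208) p.50] -/
def Qnl (L : ℕ) (U₀ : Site d → Fin d → 𝔸ˣ) (u' u₁ : Site d → 𝔸ˣ) (j : ℕ) (y : Site d) : 𝔸 :=
  mlog (util178 L U₀ u' u₁ j y)

/-- `Q′_j(u₁, λ)` is the `log ũ′ʲ` of r04's (213)–(214) (`B7Eq214General.eq214_general_of207` bounds `‖Qnl − Q′_jλ‖`).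
[cite: Balaban1985Averaging, (208) p.50, (213)–(214) p.50] -/
theorem Qnl_eq_mlog_utilG (L : ℕ) (U₀ : Site d → Fin d → 𝔸ˣ) (u' u₁ : Site d → 𝔸ˣ) (j : ℕ) (y : Site d) :
    Qnl L U₀ u' u₁ j y = mlog ((utilG L U₀ u' u₁ j y : 𝔸ˣ) : 𝔸) := by
  rw [Qnl, util178_eq_utilG]

/-- **(1.79) TYPED**: "`Q′(u₁, λ) = 0` on `𝔅_k`, `λ = (1/i) log u′`, where `Q′(u₁, λ, y) = Q′_j(u₁, λ, y)` for `y ∈ Λ_j ⊂ 𝔅_k`"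
(`𝔅_k = ⋃_{j ≤ k} Λ_j`, each `Λ_j` in its own level coordinates as in `Restr129`). [cite: Balaban1985RegularSpaces, (1.79) p.90] -/
def Cond179 (L k : ℕ) (Λ : ℕ → Set (Site d)) (U₀ : Site d → Fin d → 𝔸ˣ) (u' u₁ : Site d → 𝔸ˣ) : Prop :=
  ∀ j, j ≤ k → ∀ y ∈ Λ j, Qnl L U₀ u' u₁ j y = 0

/-- (1.78) ⇒ (1.79): `log 1 = 0`. [cite: Balaban1985RegularSpaces, (1.78)–(1.79) p.90] -/
theorem cond179_of_cond178 {L k : ℕ} {Λ : ℕ → Set (Site d)} {U₀ : Site d → Fin d → 𝔸ˣ} {u' u₁ : Site d → 𝔸ˣ}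
    (h : Cond178 L k Λ U₀ u' u₁) : Cond179 L k Λ U₀ u' u₁ := fun j hj y hy => by
  rw [Qnl, h j hj y hy, mlog_one]

/-- (1.79) ⇒ (1.78) on the domain of the logarithm: if `‖ũ′ʲ(y) − 1‖ < 1` on `𝔅_k` (where the series (21) inverts `exp`,
`MatrixLog.exp_mlog`), `log ũ′ʲ(y) = 0` forces `ũ′ʲ(y) = e⁰ = 1`. [cite: Balaban1985RegularSpaces, (1.78)–(1.79) p.90;
Balaban1985Averaging, (21) p.21] -/
theorem cond178_of_cond179 {L k : ℕ} {Λ : ℕ → Set (Site d)} {U₀ : Site d → Fin d → 𝔸ˣ} {u' u₁ : Site d → 𝔸ˣ}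
    (hdom : ∀ j, j ≤ k → ∀ y ∈ Λ j, ‖util178 L U₀ u' u₁ j y - 1‖ < 1) (h : Cond179 L k Λ U₀ u' u₁) :
    Cond178 L k Λ U₀ u' u₁ := fun j hj y hy => by
  have h0 : mlog (util178 L U₀ u' u₁ j y) = 0 := h j hj y hy
  rw [← exp_mlog (hdom j hj y hy), h0, exp_zero]

/-- **(1.78) ⇔ (1.79)** ("or equivalently", p. 90) under the domain condition `‖ũ′ʲ(y) − 1‖ < 1` on `𝔅_k`.
[cite: Balaban1985RegularSpaces, (1.78)–(1.79) p.90] -/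
theorem cond178_iff_cond179 {L k : ℕ} {Λ : ℕ → Set (Site d)} {U₀ : Site d → Fin d → 𝔸ˣ} {u' u₁ : Site d → 𝔸ˣ}
    (hdom : ∀ j, j ≤ k → ∀ y ∈ Λ j, ‖util178 L U₀ u' u₁ j y - 1‖ < 1) :
    Cond178 L k Λ U₀ u' u₁ ↔ Cond179 L k Λ U₀ u' u₁ :=
  ⟨cond179_of_cond178, cond178_of_cond179 hdom⟩

/-- **p. 90, the whole sentence**: if `u₁` satisfies (1.29) and `ũ′ʲ` stays in the domain of the logarithm on `𝔅_k`, then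
«`u′u₁` satisfies (1.29)» ⇔ (1.79) «`Q′(u₁, λ) = 0` on `𝔅_k`». [cite: Balaban1985RegularSpaces, (1.78)–(1.79) p.90, (1.29) p.81] -/
theorem restr129_mul_iff_cond179 {L k : ℕ} {Λ : ℕ → Set (Site d)} {U₀ : Site d → Fin d → 𝔸ˣ} {u₁ : Site d → 𝔸ˣ}
    (h₁ : Restr129 L k Λ U₀ u₁) {u' : Site d → 𝔸ˣ}
    (hdom : ∀ j, j ≤ k → ∀ y ∈ Λ j, ‖util178 L U₀ u' u₁ j y - 1‖ < 1) :
    Restr129 L k Λ U₀ (u' * u₁) ↔ Cond179 L k Λ U₀ u' u₁ :=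
  (restr129_mul_iff_cond178 h₁ u').trans (cond178_iff_cond179 hdom)

section Prop10

variable [NormOneClass 𝔸]

/-- **(1.78) ⇔ (1.79) with the domain condition DISCHARGED by [3] Proposition 10 at a general background**
(`B7Prop10General.prop10_general_of52`, (204): `‖ũ′ʲ(y) − 1‖ ≤ C₆α₄ ≤ 1/10 < 1` for `j ≤ k`): for `U₀` with values in an
average-closed subgroup `G ⊂ U1` satisfying (52) (`sup_p ‖U₀(∂p) − 1‖ < α₀η²`, `η = L^{−k}`), `u′` with (176)–(177), `u₁ ∈
Λ_k(U₀, α₃)` ((166)–(167)) and the explicit smallness of that theorem, (1.78) and (1.79) are equivalent on every `{Λ_j}_{j≤k}`.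
[cite: Balaban1985RegularSpaces, (1.78)–(1.79) p.90; Balaban1985Averaging, Proposition 10 p.50, (204) p.49, (176)–(177) p.45,
(166)–(167) p.44, (52) p.26] -/
theorem cond178_iff_cond179_of52 {L : ℕ} (hL : 2 ≤ L) {G : Subgroup 𝔸ˣ} (hG : AvgClosed d L G)
    {U₀ : Site d → Fin d → 𝔸ˣ} (hU : ∀ x κ, U₀ x κ ∈ G) {k : ℕ} (Λ : ℕ → Set (Site d)) {u' u₁ : Site d → 𝔸ˣ}
    {α₀ α₃ α₄ : ℝ} (hα : 0 < α₀) (hα3 : C0 d * α₀ ≤ 1 / 3) (hα2 : 2 * α₀ ≤ c2' d L)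
    (h52 : pdev U₀ < α₀ * (((L : ℝ) ^ k)⁻¹) ^ 2)
    (h176 : SiteBd u' α₄) (h177 : CovBondBd U₀ u' (α₄ * ((L : ℝ) ^ k)⁻¹))
    (hu₁ : InLambda L U₀ u₁ k α₃ (((L : ℝ) ^ k)⁻¹))
    (hα₃ : 0 ≤ α₃) (hα₃' : α₃ ≤ 1 / 50) (hα₄ : 0 ≤ α₄)
    (hs₁ : 10 * C6 d * α₄ ≤ 1) (hs₂ : 3000 * ((d : ℝ) + 1) * L * α₄ ≤ 1) (hs₃ : C4G d L * (α₀ + α₃ + α₄) ≤ 1)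
    (hs₄ : 1024 * ((d : ℝ) + 1) * ((d : ℝ) + 4) * L ^ 2 * α₀ ≤ 1) (hs₅ : 32 * ((d : ℝ) + 1) ^ 2 * C6 d * L ^ 2 * α₀ ≤ 1)
    (hs₆ : 16 * d * C5' d * C6 d * (L : ℝ) ^ 2 * α₀ ≤ 1) :
    Cond178 L k Λ U₀ u' u₁ ↔ Cond179 L k Λ U₀ u' u₁ := by
  refine cond178_iff_cond179 fun j hj y _ => ?_
  have h204 := (prop10_general_of52 hL hG hU hα hα3 hα2 h52 h176 h177 hu₁ hα₃ hα₃' hα₄ hs₁ hs₂ hs₃ hs₄ hs₅ hs₆ j hj).2 y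
  rw [util178_eq_utilG]
  calc ‖((utilG L U₀ u' u₁ j y : 𝔸ˣ) : 𝔸) - 1‖ ≤ C6 d * α₄ := h204
    _ < 1 := by linarith

end Prop10

/-! ## §6 (v1.1) The two tree encodings of `Q′_j(U₀)` agree; (213)–(214) of [3] in B8's vocabulary -/

/-- **THE TWO TREE ENCODINGS OF `Q′_j(U₀)` AGREE**: B8/B9's `Q′_j = QprimeIter (zdBlocking d L) (bgT L U₀) j` ([4] (3.19) on the
`ℤᵈ` blocks with the background transporters `Ū₀ʲ(Γ_{Ly,x})`; the operator whose null space `N(Q′(U₀))` defines (1.27)–(1.29), and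
the PROVED linear part of `R̄₀uʲ`, `B7Eq78Linearization.hasDerivAt_invI_smul_mlog_Rbar_zd`) IS r04's `B7Eq214General.lamAvgG L U₀ j`
((212)–(213) of [3], recursion (77)/(80)), for every `L, U₀, μ, j`. [cite: Balaban1985Averaging, (212)–(213) p.50, (77)–(80) p.30;
Balaban1985RegularSpaces, p.80 (sentence before (1.27))] -/
theorem qprimeIter_bgT_eq_lamAvgG (L : ℕ) (U₀ : Site d → Fin d → 𝔸ˣ) (μ : Site d → 𝔸) :
    ∀ j : ℕ, QprimeIter (zdBlocking d L) (bgT L U₀) j μ = lamAvgG L U₀ j μ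
  | 0 => rfl
  | j + 1 => by
    funext y
    rw [QprimeIter_succ, lamAvgG_succ, qprimeIter_bgT_eq_lamAvgG L U₀ μ j, rlam_apply, bmean_apply]
    show Qprime (blockSites L y) (fun _ => ((L : ℝ) ^ d)⁻¹) (bgT L U₀ j y) (lamAvgG L U₀ j μ) = _
    rw [Qprime_apply, sum_blockSites_smul]
    refine Finset.sum_congr rfl fun r _ => ?_
    simp only [bgT, axialFn, blockBase_eq_smul, add_sub_cancel_left, conjR_apply, cj_apply]

section Eq214

variable [NormOneClass 𝔸]

/-- **(213)–(214) of [3] AT A GENERAL BACKGROUND, IN B8's VOCABULARY** (the input «Using the equality (213) [3] … Q′(u₁, λ) =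
Q′λ + C′(λ)» of (1.115) p.96 and «by the inequality (214) we have |C′(λ − H′X)| < C′₂(α₃ + α₄)α₄ (1.121)»): with
`Q′_j(u₁, λ) = Qnl L U₀ u′ u₁ j` ((208), `u′ = e^{λ}`) and `Q′_j = QprimeIter (zdBlocking d L) (bgT L U₀) j` (the operator of (1.27)–(1.29)),
`‖Q′_j(u₁, λ)(z) − (Q′_jλ)(z)‖ ≤ 16C′_gen(α₃α₄ + α₄²)·Lʲη`, `η = L^{−k}`, `C′_gen = B7Eq214General.Cgen d`, for all `j ≤ k` and all `z`, under
[3]'s hypotheses (52) on `U₀` (values in an average-closed subgroup `G ⊂ U1`), (207) on `λ` (ONE-LEVEL form: `‖λ(x)‖ < α₄`,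
`‖R(U₀(b))λ(b₊) − λ(b₋)‖ < α₄η`), (166)–(167) on `u₁` and the explicit smallness of `B7Eq214General.eq214_general_of207`, of which this is
the transport along `Qnl_eq_mlog_utilG` and `qprimeIter_bgT_eq_lamAvgG`.  B8 applies (214) under its region-dependent (1.119)–(1.120)
on `{Ω_j}`; that refinement is not typed here. [cite: Balaban1985Averaging, (213)–(214) p.50, (207)–(208) p.50;
Balaban1985RegularSpaces, (1.115) p.96, (1.121) p.96] -/
theorem eq214_qprimeIter_of207 {L : ℕ} (hL : 2 ≤ L) {G : Subgroup 𝔸ˣ} (hG : AvgClosed d L G)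
    {U₀ : Site d → Fin d → 𝔸ˣ} (hU : ∀ x κ, U₀ x κ ∈ G) {k : ℕ} {u₁ : Site d → 𝔸ˣ} {α₀ α₃ α₄ : ℝ}
    (hα : 0 < α₀) (hα3 : C0 d * α₀ ≤ 1 / 3) (hα2 : 2 * α₀ ≤ c2' d L)
    (h52 : pdev U₀ < α₀ * (((L : ℝ) ^ k)⁻¹) ^ 2)
    {lam : Site d → 𝔸}
    (h207a : ∀ (x : Site d) (κ : Fin d), ‖cj (U₀ x κ) (lam (x + e κ)) - lam x‖ < α₄ * ((L : ℝ) ^ k)⁻¹)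
    (h207b : ∀ x : Site d, ‖lam x‖ < α₄)
    (hu₁ : InLambda L U₀ u₁ k α₃ (((L : ℝ) ^ k)⁻¹))
    (hα₃ : 0 ≤ α₃) (hα₃' : α₃ ≤ 1 / 200)
    (hs₁ : 200 * C6 d * α₄ ≤ 1) (hs₂ : 12000 * ((d : ℝ) + 1) * L * α₄ ≤ 1) (hs₃ : C4G d L * (α₀ + α₃ + 4 * α₄) ≤ 1)
    (hs₄ : 1024 * ((d : ℝ) + 1) * ((d : ℝ) + 4) * L ^ 2 * α₀ ≤ 1) (hs₅ : 32 * ((d : ℝ) + 1) ^ 2 * C6 d * L ^ 2 * α₀ ≤ 1)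
    (hs₆ : 16 * d * C5' d * C6 d * (L : ℝ) ^ 2 * α₀ ≤ 1) (hs₇ : 8 * d * C6 d * L * α₀ ≤ 1) :
    ∀ j ≤ k, ∀ z : Site d,
      ‖Qnl L U₀ (fun x => expUnit (lam x)) u₁ j z - QprimeIter (zdBlocking d L) (bgT L U₀) j lam z‖
        ≤ 16 * Cgen d * (α₃ * α₄ + α₄ ^ 2) * ((L : ℝ) ^ j * ((L : ℝ) ^ k)⁻¹) := by
  intro j hj z
  rw [Qnl_eq_mlog_utilG, qprimeIter_bgT_eq_lamAvgG]
  exact eq214_general_of207 hL hG hU hα hα3 hα2 h52 h207a h207b hu₁ hα₃ hα₃' hs₁ hs₂ hs₃ hs₄ hs₅ hs₆ hs₇ j hj z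

end Eq214

/-! ## §7 (v1.2) (1.77), and «(1.77) ⇒ (176), (177) on `Ω_j ⊂ T_{L^{−j}}` with `4α₄`» (p. 90) -/

/-- **(1.77) TYPED** on the `ℤᵈ` carriers: «`|λ| < α₄`, `|(Dλ)(b)| < α₄(Lʲη)⁻¹` for `b ∈ Ω_j`, `j = 0, 1, …, k − 1`» — `D = D^η_{U₀}` the
forward covariant derivative (1.1) (`B8Ineq132.covDerivFwd η U₀`, bond `b = ⟨x, x + e_μ⟩`), "`b ∈ Ω_j`" in the sense of p. 77 (a bond
belongs to `Ω` if one of its end-points does: `B8Ineq132.BondTouches`), `λ` in the lineage convention (`u′ = e^{λ}`, print's `i`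
absorbed), `|λ| < α₄` wherever `λ` is defined (print states it unqualified).  Abstract twin: `B8.LandauData.lamNorm` / the domain
(1.102); norm form: `B8ScaledSupNorm` (`|λ| ≤ α₄`, `|Dλ|_(−1) ≤ α₄`). [cite: Balaban1985RegularSpaces, (1.77) p.90] -/
def Cond177 (L k : ℕ) (η : ℝ) (Ω : ℕ → Set (Site d)) (U₀ : Site d → Fin d → 𝔸ˣ) (lam : Site d → 𝔸) (α₄ : ℝ) : Prop :=
  (∀ x : Site d, ‖lam x‖ < α₄) ∧
    ∀ j, j < k → ∀ (x : Site d) (μ : Fin d), BondTouches (Ω j) x μ →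
      ‖covDerivFwd η U₀ μ lam x‖ < α₄ * ((L : ℝ) ^ j * η)⁻¹

section Reg177

variable [NormOneClass 𝔸]

/-- **p. 90: "These conditions imply the regularity conditions (176), (177) on `Ω_j ⊂ T_{L^{−j}}`, with `4α₄` instead of `α₄`"
— the (176) part**: `‖u′(x) − 1‖ < 4α₄` for `u′ = e^{λ}`, `α₄ ≤ ¼` (r04's certificate `B7Eq214.ineq176_of_207`:
`‖e^{a} − 1‖ ≤ ‖a‖e^{‖a‖} < 4α₄`). [cite: Balaban1985RegularSpaces, p.90 (sentence after (1.77)); Balaban1985Averaging, (176) p.45] -/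
theorem reg176_of_cond177 {L k : ℕ} {η : ℝ} {Ω : ℕ → Set (Site d)} {U₀ : Site d → Fin d → 𝔸ˣ} {lam : Site d → 𝔸} {α₄ : ℝ}
    (hα₄ : α₄ ≤ 1 / 4) (h : Cond177 L k η Ω U₀ lam α₄) (x : Site d) : ‖exp (lam x) - 1‖ < 4 * α₄ :=
  B7Eq214.ineq176_of_207 (lam x) hα₄ (h.1 x)

/-- **p. 90, the (177) part "on `Ω_j ⊂ T_{L^{−j}}`, with `4α₄`"**: for a bond `b = ⟨x, x + e_μ⟩ ∈ Ω_j`, `j < k`,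
`‖u′(b₋)⁻¹R(U₀(b))u′(b₊) − 1‖ < 4α₄·L^{−j}` — (177) of [3] with the constant `4α₄` at lattice spacing `L^{−j}` (the unit of `Ω_j ⊂
T_{L^{−j}}`): since `η(Dλ)(b) = R(U₀(b))λ(b₊) − λ(b₋)`, `|(Dλ)(b)| < α₄(Lʲη)⁻¹` is `‖R(U₀(b))λ(b₊) − λ(b₋)‖ < α₄L^{−j}`, and r04's
`B7Eq214.ineq177_of_207` applies with `η ↦ L^{−j} ≤ 1` (`L ≥ 1`), `α₄ ≤ ¼`. [cite: Balaban1985RegularSpaces, p.90 (sentence after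
(1.77)); Balaban1985Averaging, (177) p.45, (207) p.50] -/
theorem reg177_of_cond177 {L k : ℕ} (hL : 1 ≤ L) {η : ℝ} (hη : 0 < η) {Ω : ℕ → Set (Site d)} {U₀ : Site d → Fin d → 𝔸ˣ}
    {lam : Site d → 𝔸} {α₄ : ℝ} (hα₄ : α₄ ≤ 1 / 4) (h : Cond177 L k η Ω U₀ lam α₄) {j : ℕ} (hj : j < k)
    {x : Site d} {μ : Fin d} (hb : BondTouches (Ω j) x μ) :
    ‖exp (-lam x) * (((U₀ x μ : 𝔸ˣ) : 𝔸) * exp (lam (x + e μ)) * (((U₀ x μ)⁻¹ : 𝔸ˣ) : 𝔸)) - 1‖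
      < 4 * α₄ * ((L : ℝ) ^ j)⁻¹ := by
  have hLj : (1 : ℝ) ≤ (L : ℝ) ^ j := one_le_pow₀ (by exact_mod_cast hL)
  refine B7Eq214.ineq177_of_207 (U₀ x μ) (lam x) (lam (x + e μ)) hα₄ (inv_le_one_of_one_le₀ hLj) (h.1 x) ?_
  -- `‖R(U₀(b))λ(b₊) − λ(b₋)‖ < α₄L^{−j}` from `|(Dλ)(b)| < α₄(Lʲη)⁻¹`
  have hD := h.2 j hj x μ hb
  have key : ‖conjR (U₀ x μ) (lam (x + e μ)) - lam x‖ * η⁻¹ < α₄ * ((L : ℝ) ^ j)⁻¹ * η⁻¹ := by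
    calc ‖conjR (U₀ x μ) (lam (x + e μ)) - lam x‖ * η⁻¹ = ‖covDerivFwd η U₀ μ lam x‖ := by
          rw [covDerivFwd, norm_smul, norm_inv, Real.norm_of_nonneg hη.le, mul_comm]
      _ < α₄ * ((L : ℝ) ^ j * η)⁻¹ := hD
      _ = α₄ * ((L : ℝ) ^ j)⁻¹ * η⁻¹ := by rw [mul_inv, mul_assoc]
  exact lt_of_mul_lt_mul_right key (inv_pos.mpr hη).le

end Reg177

/-! ## §8 (v1.3) (1.75)–(1.76) (p. 89): the regularity class of `u′` -/

section Ineq175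

variable [NormOneClass 𝔸]

omit [NormedAlgebra ℂ 𝔸] [CompleteSpace 𝔸] in
/-- **(1.75), the displayed triangle inequality** (p. 89, `b = ⟨x, x + e_μ⟩`, `R_{0,b}u′(b₊) = R(U₀(b))u′(b₊)`):
`|u′⁻¹(b₋)R_{0,b}u′(b₊) − 1| ≦ |u′⁻¹(b₋)U_{1,b}R_{0,b}u′(b₊) − 1| + |u′⁻¹(b₋)(U_{1,b} − 1)R_{0,b}u′(b₊)|`, and the second term is
`≤ |U_{1,b} − 1|` for `u′`, `U₀` with values in `U1` (unitary in print: `‖u′⁻¹(b₋)‖, ‖R_{0,b}u′(b₊)‖ ≤ 1`).  The first term is the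
bond variable of `U₁^{u′⁻¹}` in the moving frame ((55) of [3]), the quantity bounded by (1.62); the second is bounded by (1.69).
[cite: Balaban1985RegularSpaces, (1.75) p.89; Balaban1985Averaging, (55)–(56) p.27] -/
theorem ineq175 {U₀ : Site d → Fin d → 𝔸ˣ} (hU₀ : ∀ x κ, U₀ x κ ∈ U1 𝔸) (U₁ : Site d → Fin d → 𝔸ˣ) {u' : Site d → 𝔸ˣ}
    (hu' : ∀ x, u' x ∈ U1 𝔸) (x : Site d) (μ : Fin d) :
    ‖((((u' x)⁻¹ * Rc (U₀ x μ) (u' (x + e μ)) : 𝔸ˣ)) : 𝔸) - 1‖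
      ≤ ‖((((u' x)⁻¹ * U₁ x μ * Rc (U₀ x μ) (u' (x + e μ)) : 𝔸ˣ)) : 𝔸) - 1‖ + ‖((U₁ x μ : 𝔸ˣ) : 𝔸) - 1‖ := by
  have hRmem : Rc (U₀ x μ) (u' (x + e μ)) ∈ U1 𝔸 := by
    rw [Rc_apply]
    exact (U1 𝔸).mul_mem ((U1 𝔸).mul_mem (hU₀ x μ) (hu' _)) ((U1 𝔸).inv_mem (hU₀ x μ))
  have ha : ‖((((u' x)⁻¹ : 𝔸ˣ)) : 𝔸)‖ ≤ 1 := (mem_U1.1 (hu' x)).2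
  have hR : ‖((Rc (U₀ x μ) (u' (x + e μ)) : 𝔸ˣ) : 𝔸)‖ ≤ 1 := (mem_U1.1 hRmem).1
  set a : 𝔸 := (((u' x)⁻¹ : 𝔸ˣ) : 𝔸) with ha_def
  set R : 𝔸 := ((Rc (U₀ x μ) (u' (x + e μ)) : 𝔸ˣ) : 𝔸) with hR_def
  set U : 𝔸 := ((U₁ x μ : 𝔸ˣ) : 𝔸) with hU_def
  have hid : a * R - 1 = (a * U * R - 1) - a * (U - 1) * R := by noncomm_ring
  have h2 : ‖a * (U - 1) * R‖ ≤ ‖U - 1‖ := by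
    calc ‖a * (U - 1) * R‖ ≤ ‖a‖ * ‖U - 1‖ * ‖R‖ := norm_mul₃_le
      _ ≤ 1 * ‖U - 1‖ * 1 := by gcongr
      _ = ‖U - 1‖ := by ring
  simp only [Units.val_mul]
  rw [← ha_def, ← hR_def, ← hU_def, hid]
  exact (norm_sub_le _ _).trans (by linarith)

omit [NormedAlgebra ℂ 𝔸] [CompleteSpace 𝔸] in
/-- **(1.75), the displayed bound**: if the moving-frame bond variable of `U₁^{u′⁻¹}` satisfies `|u′⁻¹(b₋)U_{1,b}R_{0,b}u′(b₊) − 1| < a`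
(from (1.62)) and `|U_{1,b} − 1| < a′` (from (1.69)), then `|u′⁻¹(b₋)R_{0,b}u′(b₊) − 1| < a + a′` (print: both `< B₁(α₀ + α₁)η(Lʲη)⁻¹`
on `Ω_j`, total `< 2B₁(α₀ + α₁)η(Lʲη)⁻¹`, i.e. (177) on `Ω_j ⊂ T_{L^{−j}}`). [cite: Balaban1985RegularSpaces, (1.75) p.89] -/
theorem ineq175_lt {U₀ : Site d → Fin d → 𝔸ˣ} (hU₀ : ∀ x κ, U₀ x κ ∈ U1 𝔸) {U₁ : Site d → Fin d → 𝔸ˣ} {u' : Site d → 𝔸ˣ}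
    (hu' : ∀ x, u' x ∈ U1 𝔸) {x : Site d} {μ : Fin d} {a a' : ℝ}
    (h62 : ‖((((u' x)⁻¹ * U₁ x μ * Rc (U₀ x μ) (u' (x + e μ)) : 𝔸ˣ)) : 𝔸) - 1‖ < a)
    (h69 : ‖((U₁ x μ : 𝔸ˣ) : 𝔸) - 1‖ < a') :
    ‖((((u' x)⁻¹ * Rc (U₀ x μ) (u' (x + e μ)) : 𝔸ˣ)) : 𝔸) - 1‖ < a + a' :=
  (ineq175 hU₀ U₁ hu' x μ).trans_lt (add_lt_add h62 h69)

omit [NormedAlgebra ℂ 𝔸] [CompleteSpace 𝔸] in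
/-- **(1.76)** (p. 89: "Reasoning as in (1.70)–(1.72) we have `|u′u₁ − 1| < 16dB₁(α₀ + α₁)`. From the inequality (1.72) for `u₁` we
get `|u′ − 1| < 32dB₁(α₀ + α₁)`. (1.76)"): from `|u′u₁ − 1| < c` and `|u₁ − 1| < c` (`u₁` with values in `U1`, so that
`|u₁⁻¹ − 1| ≤ |u₁ − 1|`), `|u′ − 1| < 2c` — since `u′ − 1 = (u′u₁ − 1)u₁⁻¹ + (u₁⁻¹ − 1)`; `c = 16dB₁(α₀ + α₁)` in print.
[cite: Balaban1985RegularSpaces, (1.76) p.89, (1.72) p.88] -/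
theorem ineq176_of_mul {u' u₁ : Site d → 𝔸ˣ} (hu₁ : ∀ x, u₁ x ∈ U1 𝔸) {x : Site d} {c : ℝ}
    (h1 : ‖((u' x * u₁ x : 𝔸ˣ) : 𝔸) - 1‖ < c) (h2 : ‖((u₁ x : 𝔸ˣ) : 𝔸) - 1‖ < c) :
    ‖((u' x : 𝔸ˣ) : 𝔸) - 1‖ < 2 * c := by
  have hq : ‖((((u₁ x)⁻¹ : 𝔸ˣ)) : 𝔸)‖ ≤ 1 := (mem_U1.1 (hu₁ x)).2
  have hq1 : ‖((((u₁ x)⁻¹ : 𝔸ˣ)) : 𝔸) - 1‖ ≤ ‖((u₁ x : 𝔸ˣ) : 𝔸) - 1‖ := norm_inv_sub_one_le (hu₁ x)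
  have hid : ((u' x : 𝔸ˣ) : 𝔸) - 1
      = (((u' x * u₁ x : 𝔸ˣ) : 𝔸) - 1) * ((((u₁ x)⁻¹ : 𝔸ˣ)) : 𝔸) + (((((u₁ x)⁻¹ : 𝔸ˣ)) : 𝔸) - 1) := by
    rw [Units.val_mul, sub_mul, mul_assoc, Units.mul_inv, mul_one, one_mul]
    abel
  rw [hid]
  calc ‖(((u' x * u₁ x : 𝔸ˣ) : 𝔸) - 1) * ((((u₁ x)⁻¹ : 𝔸ˣ)) : 𝔸) + (((((u₁ x)⁻¹ : 𝔸ˣ)) : 𝔸) - 1)‖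
      ≤ ‖((u' x * u₁ x : 𝔸ˣ) : 𝔸) - 1‖ * ‖((((u₁ x)⁻¹ : 𝔸ˣ)) : 𝔸)‖ + ‖((((u₁ x)⁻¹ : 𝔸ˣ)) : 𝔸) - 1‖ :=
        (norm_add_le _ _).trans (add_le_add (norm_mul_le _ _) le_rfl)
    _ ≤ ‖((u' x * u₁ x : 𝔸ˣ) : 𝔸) - 1‖ * 1 + ‖((u₁ x : 𝔸ˣ) : 𝔸) - 1‖ := by gcongr
    _ < c * 1 + c := by
        have h0 : 0 ≤ ‖((u' x * u₁ x : 𝔸ˣ) : 𝔸) - 1‖ := norm_nonneg _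
        nlinarith
    _ = 2 * c := by ring

end Ineq175

/-! ## §9 (v1.4) (1.69) TYPED — the inductive-hypothesis bounds on `A` for `U₁ = e^{iηA}` (p. 88); READING-RULE member of row B8.Eq1.69 -/

omit [CompleteSpace 𝔸] in
/-- **(1.69) TYPED** on the `ℤᵈ` carriers (v1.4; the owed member of the READING-RULE audit of row B8.Eq1.69,
`lit-balaban-r05/READING-RULE-AUDIT-B8-g69.md` §3.9 — until now (1.69) was typed only abstractly as `B8.LandauData.Hyp169`):
«`U₁ = U′^{u₁⁻¹} = e^{iLηA′} = e^{iηA}`, `|A| < B₁(α₀ + α₁)(Lʲη)⁻¹`, `|∇^η_{U₀}A| < B₁(α₀ + α₁)(Lʲη)⁻²` on `Ω_j`,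
`j = 0, 1, …, k − 1`. (1.69)» — the bond function `A` (value `A x τ` on `b = ⟨x, x + e_τ⟩`; "on `Ω_j`" for a bond in the sense of
p. 77: one of its end-points in `Ω_j`, `B8Ineq132.BondTouches`), its forward covariant gradient `∇^η_{U₀}A` = all components
`(D^η_{U₀,κ}A_τ)(x)` of (1.1) (`B8Ineq132.covDerivFwd`), one constant `c` for both members (print: `c = B₁(α₀ + α₁)`), levels
`j < k` (print's `j = 0, 1, …, k − 1`).  The equalities `U₁ = U′^{u₁⁻¹} = e^{iηA}` DEFINE `U₁` and `A` (lineage: `U₁ = expCfg (iEta η A)`,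
`B8Eq155JBound`; `A = LA′` the rescaling) and are not clauses of the predicate.  Norm form: `B8ScaledSupNorm.bondNorm … (−1) A < c`,
`covGradNorm … (−2) A < c` (dictionary `pointwise_of_bondNorm_le`).  Companion of `Cond168` ((1.68), §4) and `Cond177` ((1.77), §7).
[cite: Balaban1985RegularSpaces, (1.69) p.88] -/
def Cond169 (L k : ℕ) (η : ℝ) (Ω : ℕ → Set (Site d)) (U₀ : Site d → Fin d → 𝔸ˣ) (A : Site d → Fin d → 𝔸) (c : ℝ) : Prop :=
  ∀ j, j < k → ∀ (x : Site d) (τ : Fin d), BondTouches (Ω j) x τ →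
    ‖A x τ‖ < c * ((L : ℝ) ^ j * η)⁻¹ ∧
      ∀ κ : Fin d, ‖covDerivFwd η U₀ κ (fun z => A z τ) x‖ < c * (((L : ℝ) ^ j * η)⁻¹) ^ 2

omit [CompleteSpace 𝔸] in
/-- (1.69) unfolded at one bond. [cite: Balaban1985RegularSpaces, (1.69) p.88] -/
theorem cond169_apply {L k : ℕ} {η : ℝ} {Ω : ℕ → Set (Site d)} {U₀ : Site d → Fin d → 𝔸ˣ} {A : Site d → Fin d → 𝔸} {c : ℝ}
    (h : Cond169 L k η Ω U₀ A c) {j : ℕ} (hj : j < k) {x : Site d} {τ : Fin d} (hb : BondTouches (Ω j) x τ) :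
    ‖A x τ‖ < c * ((L : ℝ) ^ j * η)⁻¹ ∧ ∀ κ : Fin d, ‖covDerivFwd η U₀ κ (fun z => A z τ) x‖ < c * (((L : ℝ) ^ j * η)⁻¹) ^ 2 :=
  h j hj x τ hb

omit [CompleteSpace 𝔸] in
/-- (1.69) is monotone in the constant: `c ≤ c′` (`η ≥ 0`). [cite: Balaban1985RegularSpaces, (1.69) p.88] -/
theorem cond169_mono {L k : ℕ} {η : ℝ} (hη : 0 ≤ η) {Ω : ℕ → Set (Site d)} {U₀ : Site d → Fin d → 𝔸ˣ} {A : Site d → Fin d → 𝔸}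
    {c c' : ℝ} (hcc' : c ≤ c') (h : Cond169 L k η Ω U₀ A c) : Cond169 L k η Ω U₀ A c' := by
  intro j hj x τ hb
  have hr : 0 ≤ ((L : ℝ) ^ j * η)⁻¹ := inv_nonneg.mpr (by positivity)
  obtain ⟨h1, h2⟩ := h j hj x τ hb
  exact ⟨h1.trans_le (mul_le_mul_of_nonneg_right hcc' hr),
    fun κ => (h2 κ).trans_le (mul_le_mul_of_nonneg_right hcc' (by positivity))⟩

omit [CompleteSpace 𝔸] in
/-- (1.69) for `{Ω_j}` implies (1.69) for any levelwise smaller family (`Ω′_j ⊆ Ω_j`) and fewer levels (`k′ ≤ k`) — p. 88: the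
conditions «imply the same conditions for `k − 1` (we do not consider the set `Ω_k`)». [cite: Balaban1985RegularSpaces, (1.69) p.88] -/
theorem cond169_anti {L k k' : ℕ} (hk : k' ≤ k) {η : ℝ} {Ω Ω' : ℕ → Set (Site d)} (hΩ : ∀ j, Ω' j ⊆ Ω j)
    {U₀ : Site d → Fin d → 𝔸ˣ} {A : Site d → Fin d → 𝔸} {c : ℝ} (h : Cond169 L k η Ω U₀ A c) : Cond169 L k' η Ω' U₀ A c := by
  intro j hj x τ hb
  refine h j (lt_of_lt_of_le hj hk) x τ ?_
  rcases hb with hb | hb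
  exacts [Or.inl (hΩ j hb), Or.inr (hΩ j hb)]

end Literature.MathematicalPhysics.QuantumFieldTheory.Balaban1983to89.B8Eq178Averages
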